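import Mathlib
import Summits.Ventures.PercRepro2.SwOutAll
import Summits.Ventures.PercRepro2.SwOutSeriesDefs
import Summits.Ventures.PercRepro2.SwOutLeaf
import Summits.Ventures.PercRepro2.SwOutLoop
import Summits.Ventures.PercRepro2.SwOutCyclicDefs
import Summits.Ventures.PercRepro2.SwOutJunctionSplit

/-!
# Junction regions: vocabulary and bookkeeping (blind cell PercRepro2, night-4 g11, 2026-08-25;
proofs/NIGHT4-G11.md §3)

A JUNCTION REGION at `u` (`JunctionRegion`): every vertex of `U` other than `h, o, u` has an outside
edge or is a path vertex (all its edges inside `U`, at most two of them).  The JUNCTION CONDITION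
(`JunctionAdj`): every neighbour `p ≠ h` of `u` is adjacent to `h`.  The BAD edges (`badEdgesJ`):
the edges at a non-mark vertex other than `u` without outside edge, and the loops at `h` and at
`u`.  The bookkeeping for the induction of `SwOutJunctionInd`: a junction region stays a junction
region and the junction condition survives under the series contraction / deletion, the leaf
deletion and the loop parking at a vertex other than `u` (`junctionRegion_contract`,
`junctionRegion_delete`, `junctionAdj_of_agree`, …).
-/

namespace Summit.Ventures.PercRepro2

namespace LocRows

open Hull

variable {V : Type*} {E : Type*} [Fintype E] [DecidableEq E]

open scoped Classical

variable (ends : E → Sym2 V) (h o u : V)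

/-- A JUNCTION REGION at `u`: every vertex other than `h, o, u` has an outside edge or is a path
vertex. -/
def JunctionRegion (U : Set V) : Prop :=
  ∀ x ∈ U, x ≠ h → x ≠ o → x ≠ u → HasOut ends U x ∨
    ((∀ e, x ∈ ends e → ∀ y ∈ ends e, y ∈ U) ∧ (edgesAt ends x).card ≤ 2)

/-- The JUNCTION CONDITION: every neighbour `p ≠ h` of `u` is adjacent to `h`. -/
def JunctionAdj : Prop := ∀ e p, ends e = s(u, p) → p ≠ h → ∃ e', ends e' = s(p, h)

/-- The BAD edges of a junction region: the edges at a non-mark vertex other than `u` without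
outside edge, and the loops at `h` and at `u`. -/
noncomputable def badEdgesJ (U : Set V) : Finset E :=
  Finset.univ.filter fun e =>
    (∃ x ∈ ends e, x ∈ U ∧ x ≠ h ∧ x ≠ o ∧ x ≠ u ∧ ¬ HasOut ends U x) ∨
      ends e = s(h, h) ∨ ends e = s(u, u)

variable {ends h o u}

omit [Fintype E] [DecidableEq E] in
/-- The junction condition in the form used by the junction theorem. -/
lemma hadj_of_junctionAdj (hJ : JunctionAdj ends h u) :
    ∀ e (he : u ∈ ends e), Sym2.Mem.other he ≠ h → ∃ e', ends e' = s(Sym2.Mem.other he, h) :=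
  fun e he hph => hJ e _ (ends_eq_other he) hph

omit [DecidableEq E] in
/-- Membership in `badEdgesJ`. -/
lemma mem_badEdgesJ {U : Set V} {e : E} :
    e ∈ badEdgesJ ends h o u U ↔
      (∃ x ∈ ends e, x ∈ U ∧ x ≠ h ∧ x ≠ o ∧ x ≠ u ∧ ¬ HasOut ends U x) ∨
        ends e = s(h, h) ∨ ends e = s(u, u) := by
  simp only [badEdgesJ, Finset.mem_filter, Finset.mem_univ, true_and]

omit [DecidableEq E] in
/-- Bad edges transfer upward for unchanged edges. -/
lemma mem_badEdgesJ_of_agree {U : Set V} {ends' : E → Sym2 V} {U' : Set V} (hU' : U' ⊆ U)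
    (hout : ∀ y ∈ U', HasOut ends U y → HasOut ends' U' y) {e : E} (he : ends' e = ends e)
    (hbad : e ∈ badEdgesJ ends' h o u U') : e ∈ badEdgesJ ends h o u U := by
  rw [mem_badEdgesJ] at hbad ⊢
  rw [he] at hbad
  rcases hbad with ⟨y, hy, hyU, hyh, hyo, hyu, hyout⟩ | hloop
  · exact Or.inl ⟨y, hy, hU' hyU, hyh, hyo, hyu, fun h' => hyout (hout y hyU h')⟩
  · exact Or.inr hloop

/-- The count of bad edges drops when they shrink to a subset of the old ones minus one. -/
lemma card_badEdgesJ_lt {U : Set V} {ends' : E → Sym2 V} {U' : Set V} {e₀ : E}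
    (he₀ : e₀ ∈ badEdgesJ ends h o u U)
    (hsub : badEdgesJ ends' h o u U' ⊆ (badEdgesJ ends h o u U).erase e₀) :
    (badEdgesJ ends' h o u U').card < (badEdgesJ ends h o u U).card :=
  lt_of_le_of_lt (Finset.card_le_card hsub) (Finset.card_erase_lt_of_mem he₀)

omit [Fintype E] [DecidableEq E] in
/-- **The junction condition survives** an operation that keeps every edge at `u` whose other end is
not `h`, together with the witnesses of those neighbours. -/
lemma junctionAdj_of_agree {ends' : E → Sym2 V} (hJ : JunctionAdj ends h u)
    (h1 : ∀ e p, ends' e = s(u, p) → p ≠ h → ends' e = ends e)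
    (h2 : ∀ e p, ends' e = s(u, p) → p ≠ h → ∀ e', ends e' = s(p, h) → ends' e' = ends e') :
    JunctionAdj ends' h u := by
  intro e p hep hph
  have hold : ends e = s(u, p) := (h1 e p hep hph) ▸ hep
  obtain ⟨e', he'⟩ := hJ e p hold hph
  exact ⟨e', by rw [h2 e p hep hph e' he']; exact he'⟩

omit [Fintype E] in
/-- A loop-valued update of one edge at a vertex `v ∉ {u, h}` (parking, deleting) keeps the
junction condition: the updated edge is neither at `u` nor a witness. -/
lemma junctionAdj_update_loop (hJ : JunctionAdj ends h u) {e₁ : E} {v : V} (hvu : v ≠ u)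
    (hwit : ∀ p, ends e₁ = s(p, h) → p ≠ h → ∀ e, ends e = s(u, p) → e = e₁) :
    JunctionAdj (Function.update ends e₁ s(v, v)) h u := by
  refine junctionAdj_of_agree hJ ?_ ?_
  · intro e p hep hph
    have hne : e ≠ e₁ := by
      rintro rfl
      rw [Function.update_self, Sym2.eq_iff] at hep
      rcases hep with ⟨h', _⟩ | ⟨_, h'⟩
      · exact hvu h'
      · exact hvu h'
    rw [Function.update_of_ne hne]
  · intro e p hep hph e' he'
    have hne : e ≠ e₁ := by
      rintro rfl
      rw [Function.update_self, Sym2.eq_iff] at hep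
      rcases hep with ⟨h', _⟩ | ⟨_, h'⟩
      · exact hvu h'
      · exact hvu h'
    rw [Function.update_of_ne hne] at hep
    have hne' : e' ≠ e₁ := by
      rintro rfl
      exact hne (hwit p he' hph e hep)
    rw [Function.update_of_ne hne']

omit [Fintype E] in
/-- Parking a loop keeps the junction condition (`u ≠ l`). -/
lemma junctionAdj_parkLoop (hJ : JunctionAdj ends h u) {l : V} {e₁ : E} {v : V}
    (hloop : ends e₁ = s(v, v)) (hul : u ≠ l) :
    JunctionAdj (parkLoop ends l e₁) h u := by
  refine junctionAdj_update_loop hJ hul.symm ?_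
  intro p hp hph e _
  exfalso
  rw [hloop, Sym2.eq_iff] at hp
  rcases hp with ⟨h', h''⟩ | ⟨h', h''⟩
  · exact hph (h'.symm.trans h'')
  · exact hph (h''.symm.trans h')

section Region

variable {U : Set V}

/-- A junction region stays a junction region after contracting a series vertex `x ≠ u` without
outside edge. -/
lemma junctionRegion_contract {x p q : V} {e₀ e₁ : E} (hcyc : JunctionRegion ends h o u U)
    (hne : e₀ ≠ e₁) (hp : ends e₀ = s(x, p)) (hq : ends e₁ = s(x, q)) (hpx : p ≠ x) (hqx : q ≠ x)
    (hpU : p ∈ U) (hqU : q ∈ U) (hin : ∀ e, x ∈ ends e → ∀ y ∈ ends e, y ∈ U)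
    (honly : ∀ e, x ∈ ends e → e = e₀ ∨ e = e₁)
    (houtC : ∀ y ∈ U \ {x}, HasOut ends U y →
      HasOut (contractSeries ends x p q e₀ e₁) (U \ {x}) y) :
    JunctionRegion (contractSeries ends x p q e₀ e₁) h o u (U \ {x}) := by
  intro y hyU hyh hyo hyu
  rcases hcyc y hyU.1 hyh hyo hyu with hout' | ⟨hin', hcard'⟩
  · exact Or.inl (houtC y hyU hout')
  · right
    have hyx : y ≠ x := fun h' => hyU.2 (Set.mem_singleton_iff.2 h')
    have hye : ∀ e', y ∈ contractSeries ends x p q e₀ e₁ e' →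
        e' ≠ e₀ ∧ (e' = e₁ ∨ y ∈ ends e') := by
      intro e' hy'
      by_cases h₀ : e' = e₀
      · subst h₀
        rw [contractSeries_apply_e₁, Sym2.mem_iff] at hy'
        rcases hy' with rfl | rfl <;> exact absurd rfl hyx
      by_cases h₁ : e' = e₁
      · exact ⟨h₀, Or.inl h₁⟩
      · rw [contractSeries_apply_of_ne h₀ h₁] at hy'; exact ⟨h₀, Or.inr hy'⟩
    refine ⟨fun e' hy' z hz => ?_, ?_⟩
    · have h₀ : e' ≠ e₀ := (hye e' hy').1
      by_cases h₁ : e' = e₁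
      · subst h₁
        rw [contractSeries_apply_e₂ hne, Sym2.mem_iff] at hz
        rcases hz with rfl | rfl
        · exact ⟨hpU, fun h' => hpx (Set.mem_singleton_iff.1 h')⟩
        · exact ⟨hqU, fun h' => hqx (Set.mem_singleton_iff.1 h')⟩
      · rw [contractSeries_apply_of_ne h₀ h₁] at hy' hz
        refine ⟨hin' e' hy' z hz, ?_⟩
        rintro rfl
        rcases honly e' hz with rfl | rfl
        · exact h₀ rfl
        · exact h₁ rfl
    · by_cases hy₀ : e₀ ∈ edgesAt ends y
      · have hsub : edgesAt (contractSeries ends x p q e₀ e₁) y ⊆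
            insert e₁ ((edgesAt ends y).erase e₀) := by
          intro e' he'
          rw [mem_edgesAt] at he'
          obtain ⟨h₀, h₁⟩ := hye e' he'
          rw [Finset.mem_insert, Finset.mem_erase]
          rcases h₁ with rfl | hy''
          · exact Or.inl rfl
          · exact Or.inr ⟨h₀, mem_edgesAt.2 hy''⟩
        calc (edgesAt (contractSeries ends x p q e₀ e₁) y).card
            ≤ (insert e₁ ((edgesAt ends y).erase e₀)).card := Finset.card_le_card hsub
          _ ≤ ((edgesAt ends y).erase e₀).card + 1 := Finset.card_insert_le _ _
          _ = (edgesAt ends y).card := by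
            rw [Finset.card_erase_of_mem hy₀]
            have : 0 < (edgesAt ends y).card := Finset.card_pos.2 ⟨e₀, hy₀⟩
            omega
          _ ≤ 2 := hcard'
      · have hsub : edgesAt (contractSeries ends x p q e₀ e₁) y ⊆ edgesAt ends y := by
          intro e' he'
          rw [mem_edgesAt] at he' ⊢
          obtain ⟨h₀, h₁⟩ := hye e' he'
          rcases h₁ with rfl | hy''
          · rw [contractSeries_apply_e₂ hne, Sym2.mem_iff] at he'
            rcases he' with rfl | rfl
            · exact absurd (mem_edgesAt.2 (by rw [hp]; exact Sym2.mem_mk_right x y)) hy₀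
            · rw [hq]; exact Sym2.mem_mk_right x y
          · exact hy''
        exact (Finset.card_le_card hsub).trans hcard'

/-- A junction region stays a junction region after deleting a series vertex `x ≠ u` without
outside edge. -/
lemma junctionRegion_delete {x : V} {e₀ e₁ : E} (hcyc : JunctionRegion ends h o u U)
    (hne : e₀ ≠ e₁) (hin : ∀ e, x ∈ ends e → ∀ y ∈ ends e, y ∈ U)
    (honly : ∀ e, x ∈ ends e → e = e₀ ∨ e = e₁)
    (houtD : ∀ y ∈ U \ {x}, HasOut ends U y → HasOut (deleteSeries ends x e₀ e₁) (U \ {x}) y) :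
    JunctionRegion (deleteSeries ends x e₀ e₁) h o u (U \ {x}) := by
  intro y hyU hyh hyo hyu
  rcases hcyc y hyU.1 hyh hyo hyu with hout' | ⟨hin', hcard'⟩
  · exact Or.inl (houtD y hyU hout')
  · right
    have hyx : y ≠ x := fun h' => hyU.2 (Set.mem_singleton_iff.2 h')
    have hye : ∀ e', y ∈ deleteSeries ends x e₀ e₁ e' → (e' ≠ e₀ ∧ e' ≠ e₁) ∧ y ∈ ends e' := by
      intro e' hy'
      by_cases h₀ : e' = e₀
      · subst h₀
        rw [deleteSeries_apply_e₁, Sym2.mem_iff] at hy'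
        rcases hy' with rfl | rfl <;> exact absurd rfl hyx
      by_cases h₁ : e' = e₁
      · subst h₁
        rw [deleteSeries_apply_e₂ hne, Sym2.mem_iff] at hy'
        rcases hy' with rfl | rfl <;> exact absurd rfl hyx
      · rw [deleteSeries_apply_of_ne h₀ h₁] at hy'; exact ⟨⟨h₀, h₁⟩, hy'⟩
    refine ⟨fun e' hy' z hz => ?_, (Finset.card_le_card
      (edgesAt_subset_of fun e' hy' => (hye e' hy').2)).trans hcard'⟩
    obtain ⟨⟨h₀, h₁⟩, hy''⟩ := hye e' hy'
    rw [deleteSeries_apply_of_ne h₀ h₁] at hz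
    refine ⟨hin' e' hy'' z hz, ?_⟩
    rintro rfl
    rcases honly e' hz with rfl | rfl
    · exact h₀ rfl
    · exact h₁ rfl

omit [DecidableEq E] in
/-- A junction region stays a junction region after a loop-valued update of an edge `e₁` whose
loop vertex `v` is not in the smaller region `U'` and whose old ends are all inside `U`
(parking a loop, deleting a leaf), for `U' ⊆ U` with `U ∖ U'` disjoint from the path vertices'
neighbourhoods — stated in the form the induction uses: the edges at a path vertex `y ∈ U'`
other than `e₁` are unchanged and `e₁` is not at `y`. -/
lemma junctionRegion_update_loop {ends' : E → Sym2 V} {U' : Set V} (hU' : U' ⊆ U)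
    (hcyc : JunctionRegion ends h o u U)
    (hout : ∀ y ∈ U', HasOut ends U y → HasOut ends' U' y)
    (hye : ∀ y ∈ U', y ≠ h → y ≠ o → y ≠ u → ∀ e', y ∈ ends' e' → ends' e' = ends e')
    (hUin : ∀ y ∈ U', y ≠ h → y ≠ o → y ≠ u →
      (∀ e, y ∈ ends e → ∀ z ∈ ends e, z ∈ U) → ∀ e, y ∈ ends' e → ∀ z ∈ ends' e, z ∈ U') :
    JunctionRegion ends' h o u U' := by
  intro y hyU hyh hyo hyu
  rcases hcyc y (hU' hyU) hyh hyo hyu with hout' | ⟨hin', hcard'⟩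
  · exact Or.inl (hout y hyU hout')
  · right
    refine ⟨hUin y hyU hyh hyo hyu hin', ?_⟩
    refine (Finset.card_le_card (edgesAt_subset_of fun e' hy' => ?_)).trans hcard'
    rw [← hye y hyU hyh hyo hyu e' hy']
    exact hy'

end Region

omit [Fintype E] [DecidableEq E] in
/-- A series vertex `x ≠ h` adjacent to the junction `u` has `h` as its other neighbour (the
junction condition applied to the edge `x u`). -/
lemma series_nbr_of_u {x p q : V} {e₀ e₁ : E} (hs : IsSeriesAt ends x p q e₀ e₁) (hxh : x ≠ h)
    (hhu : h ≠ u) (hJ : JunctionAdj ends h u) (hpu : p = u) : q = h := by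
  subst hpu
  obtain ⟨e'', he''⟩ := hJ e₀ x (ends_swap hs.ends₁) hxh
  have hxe'' : x ∈ ends e'' := by rw [he'']; exact Sym2.mem_mk_left x h
  rcases hs.only e'' hxe'' with rfl | rfl
  · rw [hs.ends₁, Sym2.eq_iff] at he''
    rcases he'' with ⟨_, h2⟩ | ⟨h1, _⟩
    · exact absurd h2 hhu.symm
    · exact absurd h1 hxh
  · rw [hs.ends₂, Sym2.eq_iff] at he''
    rcases he'' with ⟨_, h2⟩ | ⟨h1, _⟩
    · exact h2
    · exact absurd h1 hxh

omit [Fintype E] [DecidableEq E] in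
/-- The contracted edge `s(p, q)` of a series vertex `x ≠ h` is never an edge `s(u, p')` at the
junction with `p' ≠ h`. -/
lemma contracted_not_at_u {x p q : V} {e₀ e₁ : E} (hs : IsSeriesAt ends x p q e₀ e₁) (hxh : x ≠ h)
    (hhu : h ≠ u) (hJ : JunctionAdj ends h u) {p' : V} (hep : s(p, q) = s(u, p')) (hph : p' ≠ h) :
    False := by
  rw [Sym2.eq_iff] at hep
  rcases hep with ⟨h1, h2⟩ | ⟨h1, h2⟩
  · exact hph (h2.symm.trans (series_nbr_of_u hs hxh hhu hJ h1))
  · exact hph (h1.symm.trans (series_nbr_of_u hs.symm hxh hhu hJ h2))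

end LocRows

end Summit.Ventures.PercRepro2
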